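import Literature.MathematicalPhysics.QuantumFieldTheory.Balaban1983to89.B9Eq3132StepDifference
import Literature.MathematicalPhysics.QuantumFieldTheory.Balaban1983to89.QGQInverse

/-!
# `Balaban1983to89.B9Eq3132CoerciveFromGA` — T. Bałaban, *Propagators for lattice gauge theories in a background field*, Commun. Math. Phys. **99** (1985)
# 389–434 [Balaban1985BackgroundPropagators], (3.132) p. 422 under Theorem 3.12's prefix p. 423: THE Λ²-COERCIVITY OF `(QG_DQ*)(U)` AND `(QG₁Q*)(U)`
# (the `CoerciveUnder` inputs of the N06 row-26 Combes–Thomas face) TRANSFERRED from the Λ²-coercivity of `(QG₀Q*)(U)` for the Sect. A–C propagator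
# `G₀ = Δ_a⁻¹` along the perturbation series (3.130) ∕ (3.138) — ROW 20's displayed steps and identities, the small factor `Mα₀` kept

[4] = T. Bałaban, *Propagators and renormalization transformations for lattice gauge theories. II*, Commun. Math. Phys. **96** (1984) 223–250 [`Balaban1984PropagatorsII`].

statement-level skeleton of published theorems with citation tags; proofs where landed; nothing here is a claim about the Yang–Mills mass gap

THE PRINT.  [B9] p. 421: *«Let us denote for a moment the operator we have investigated in previous sections by G₀, i.e. G₀ = (Δ + DRD* + Q*aQ)⁻¹.
From (3.120) we get G = G₀(I − Δ′_πG₀)⁻¹ = Σ_{n=0}^∞ G₀(Δ′_πG₀)ⁿ. (3.130)»*; p. 422: *«This inequality [(3.131)] and Theorem 3.3 for G₀ imply a convergence of the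
series (3.130), for α₀ sufficiently small … each operator Δ′_π provides the small factor α₀ … The operators (QG̃Q*)⁻¹, or (QG₁Q*)⁻¹, can be analyzed in the same
way as the operator (Q′G′²Q′*)⁻¹ … |(QG̃Q*)⁻¹(y, y′)| ≤ O(1)(Lʲη)⁻²(L^{j′}η)^{−d}e^{−δ₁d(y,y′)} (3.132)»*; p. 423 (3.138) *«G₁ = G₀(I − (Δ′_π + Δ⁽²⁾_π)G₀)⁻¹»* and
Theorem 3.12 (prefix: (3.35), (3.36), α₀ small); [4] (2.147) p. 249 *«⟨λ, QGQ*λ⟩ ≥ γ₀ Σ_y Λ_y²|λ(y)|²»* (at U = 1), Lemma 2.1 (2.60)–(2.61) p. 234.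

WHY THIS FILE (dag-n06-i gen 13, N06 bundle F4, row 26).  After `B9Eq3132DecayFromMajorant.hdec26_of_step12` (gen 12) the certificate of record
`…N06AtOpsYNuOfRecordV6EPairML2` displays for ROW 26 only the two COERCIVITY binders `hco26 ∕ hco₁26` — Λ²-coercivity of the normalised real matrices of
`Q G_D(U) Q*` and `Q G₁(U) Q*`.  ROW 20's displayed `hmodel12` already carries, at the coordinate pins, the (3.131)∕(3.137) STEPS (block majorant
`θ₁(Mα₀)·e^{−δ_K d}` of `G₀Δ′_π`, `G₀(Δ′_π + Δ⁽²⁾_π)` in the state norm 𝔠⁽²⁾) and the IDENTITIES `G₀Δ_a = 1`, `(Δ_a − Δ′_π)G = 1`, `(Δ_a − Δ′_π − Δ⁽²⁾_π)G₁ = 1`,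
whence `G − G₀ = G₀Δ′_πG` and `G₁ − G₀ = G₀(Δ′_π + Δ⁽²⁾_π)G₁` have [4]-(2.51) majorants CARRYING THE SMALL FACTOR `Mα₀`; through gen 12's (2.142)-at-`U`
(`B9Eq3132Ineq2142Covariant.norm_QGQOfY_deltaY_le`) the normalised differences have entries `≤ K·(Mα₀)·e^{−(ρ∕2)d}`, through Schur ((2.61)) a form bound
`≤ K′(Mα₀)‖v‖²`, and `QGQInverse.coercive_of_form_perturbation` transfers the coercivity of `Q G₀(U) Q*` (constant γ) to BOTH `Q G_D(U) Q*` and `Q G₁(U) Q*`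
(constant γ∕2) once `Mα₀ ≤ γ∕(2(K′+1))` — §7.2 of the cell's written repair `QGQ-inverse-proof.md` (the perturbation route), over landed objects.
After this file the knit displays for row 26 ONE coercivity binder `hcoA` about the GENUINE Sect. A–C letter `(lettersYOfRecordV4 …).GA` (rows 18–19's
`G`) and one more coordinate pin `hG0co12` (row 20's `G₀` IS that letter — the pin `hGcoA` of rows 18–19 verbatim).

WHAT IS PROVED (sorry-free; bookkeeping over landed objects; part 1 = `B9Eq3132StepDifference`: the difference majorants `subMajorants_of_step12`, the
linearity `GcoK_sub ∕ QGQOfY_sub ∕ normMatY_sub`, the explicit one-configuration entry bound `abs_normMatY_QGQOfY_le_of_hasMajorant`).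
* §5 `form_abs_le_of_entry_decay` (Schur on `X × F` from an entry decay and a row-sum bound).
* §6 ★★ `coerciveUnder_of_subMajorants` (generic `𝔸`, `G`: `CoerciveUnder` passes from a letter family `T₀` to `T` along `(Mα₀)`-small difference majorants).
* §7 ★★★ `hco26_of_hcoA_step12` — at def-Y's v4 record (`𝔸 = M_N(ℂ)`, `G = SU(N)`): the certificate's `hco26 ∧ hco₁26` TYPES VERBATIM from ONE binder
  `hcoA : CoerciveUnder … (fun x U => normMatY b (lamInvY x.toKIdx) (QGQOfY x.toKIdx (parBY x.toKIdx) (lettersYOfRecordV4 N θ M⋆ 𝔯 x).GA U))` and row 20's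
  displayed inputs + pins (+ `hG0co`).

HONEST SCOPE.  `hcoA` — Λ²-coercivity of `Q G₀(U) Q*` uniformly on (3.35)∕(3.36), [4] (2.147) transported to `U` (at `U = 1` a tree theorem:
`B6QGQCoerciveKLevelV1.prop27_kLevel_unconditional`, `B9Eq3132NuBindersAtOne.binders_lam_lettersYOfRecordV4_one`) — STAYS a displayed hypothesis (its
discharge is the written repair's Lemma P′: explicit test fields + an energy bound at def-Y's `deltaAY ∕ QY`, with `QGQInverse.qgq_coercive_of_approx_right_inverse`);
in `b`-coordinates it presumes a basis `b` orthonormal for `Re tr(X*Y)` up to the constant (the transporters act on the fibre at `U ≠ 1`).  Theorem 3.3 for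
`G₀`, (3.131), (3.137) and the identities remain ROW 20's displayed hypotheses of printed shape; nothing of [B9] or [4] is asserted; count-neutral; N06 NOT
discharged; one finite 𝕋^{d+1} programme at fixed ε — nothing continuum, nothing OS, nothing about the mass gap.  Cell `pub-ymgap` (HUMAN RULING D-0062),
Track A node N06 [B9], seat `pub-ymgap-dag-n06-i` (gen 13), 2026-08-27; a NEW file.
-/

noncomputable section

namespace Literature.MathematicalPhysics.QuantumFieldTheory.Balaban1983to89.B9Eq3132CoerciveFromGA

open B6RandomWalk (HasMajorant)
open B9CoReadingCoords (XBK blkBK GcoK)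
open B6Ineq2142KLevelV1 (lvl β)
open B9Eq3132StepDifference (subMajorants_of_step12 QGQOfY_sub normMatY_sub abs_normMatY_QGQOfY_le_of_hasMajorant)
open B9Thm39ReadingCoords (basisBound39)
open B9Eq3132RingInverseReading (dimConstY' dimConstY'_pos)

variable {𝔸 : Type} [NormedRing 𝔸] [NormedAlgebra ℂ 𝔸]

/-! ## §5 Schur on `X × F`: a form bound from an entry decay and a row sum -/

section Schur

open Matrix
open QGQInverse (form_abs_le_of_schur)

/-- **SCHUR'S FORM BOUND FROM AN ENTRY DECAY**: if `|E (y,f) (y′,f′)| ≤ K e^{−σ d(y,y′)}` for a symmetric `d` with `Σ_{y′} e^{−σ d(y,y′)} ≤ c` ((2.61)), then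
`|v·Ev| ≤ (K·|F|·c)‖v‖²` (row sums = column sums ≤ K·|F|·c; `QGQInverse.form_abs_le_of_schur`). [cite: Balaban1984PropagatorsII, Lemma 2.1 (2.61) p.234; Balaban1985BackgroundPropagators, (3.132) p.422 (bookkeeping)] -/
theorem form_abs_le_of_entry_decay {X F : Type} [Fintype X] [Fintype F] (E : Matrix (X × F) (X × F) ℝ) (dist : X → X → ℝ) {K σ c : ℝ}
    (hK : 0 ≤ K) (hsymm : ∀ y y', dist y y' = dist y' y) (hrow : ∀ y, ∑ y', Real.exp (-(σ * dist y y')) ≤ c)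
    (hE : ∀ a b, |E a b| ≤ K * Real.exp (-(σ * dist a.1 b.1))) (v : X × F → ℝ) :
    |v ⬝ᵥ (E *ᵥ v)| ≤ K * (Fintype.card F) * c * (v ⬝ᵥ v) := by
  have hc : ∀ y, 0 ≤ c := fun y => (Finset.sum_nonneg fun y' _ => Real.exp_nonneg _).trans (hrow y)
  have hR : ∀ a : X × F, ∑ b, |E a b| ≤ K * (Fintype.card F) * c := by
    intro a
    calc ∑ b, |E a b| ≤ ∑ b : X × F, K * Real.exp (-(σ * dist a.1 b.1)) := Finset.sum_le_sum fun b _ => hE a b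
      _ = K * ((Fintype.card F) * ∑ y', Real.exp (-(σ * dist a.1 y'))) := by
          rw [Fintype.sum_prod_type, Finset.mul_sum, Finset.mul_sum]
          refine Finset.sum_congr rfl fun y' _ => ?_
          simp only [Finset.sum_const, Finset.card_univ, nsmul_eq_mul]; ring
      _ ≤ K * ((Fintype.card F) * c) := mul_le_mul_of_nonneg_left (mul_le_mul_of_nonneg_left (hrow a.1) (Nat.cast_nonneg _)) hK
      _ = _ := by ring
  have hC : ∀ b : X × F, ∑ a, |E a b| ≤ K * (Fintype.card F) * c := by
    intro b
    calc ∑ a, |E a b| ≤ ∑ a : X × F, K * Real.exp (-(σ * dist a.1 b.1)) := Finset.sum_le_sum fun a _ => hE a b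
      _ = K * ((Fintype.card F) * ∑ y', Real.exp (-(σ * dist b.1 y'))) := by
          rw [Fintype.sum_prod_type, Finset.mul_sum, Finset.mul_sum]
          refine Finset.sum_congr rfl fun y' _ => ?_
          simp only [Finset.sum_const, Finset.card_univ, nsmul_eq_mul, hsymm y' b.1]; ring
      _ ≤ K * ((Fintype.card F) * c) := mul_le_mul_of_nonneg_left (mul_le_mul_of_nonneg_left (hrow b.1) (Nat.cast_nonneg _)) hK
      _ = _ := by ring
  by_cases hX : Nonempty X
  · have hρ : 0 ≤ K * (Fintype.card F) * c := mul_nonneg (mul_nonneg hK (Nat.cast_nonneg _)) (hc (Classical.arbitrary X))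
    exact form_abs_le_of_schur E hρ (by rw [sq]) hR hC v
  · have hv : v = 0 := funext fun a => (hX ⟨a.1⟩).elim
    subst hv
    simp

end Schur

/-! ## §6 ★★ The family transfer: `CoerciveUnder` from `T₀` to `T` along `(Mα₀)`-small difference majorants -/

section Transfer

open Node00 (IBondY FBondY CfgY BondOpY BondParY QGQOfY)
open B6KLevelCensusIndexV1 (KIdx)
open B6GlobalChartV1 (blkV1)
open B9Thm34Ext (toB6)
open B9PinMembersKLevelV1 (MemberY geo9Y bg9Y)
open B9GeoLemma21KLevelV1 (geo9K_len_pos rowSum261_geo9Y geo9Y_dist_comm)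
open B9RWSumsReadsNbr (nbr)
open B9Eq3132RingInverseReading (normMatY)
open B9Eq3132NuReading (lamInvY)
open B9Eq3132CTInputs (CoerciveUnder)
open B9Eq3132ScalarIndex (geoComap)
open Matrix
open QGQInverse (Coercive coercive_of_form_perturbation)

variable {κ : Type} [Fintype κ] [DecidableEq κ] {Ff : Type} [Fintype Ff] [DecidableEq Ff]
variable {d ℓ : ℕ} {hd : 1 ≤ d + 1} {hL : Odd (ℓ + 1) ∧ 1 < ℓ + 1} {b₀ b₁ : ℝ} {Mstar : ℕ}
variable [CompleteSpace 𝔸] [FiniteDimensional ℝ 𝔸] {G : Subgroup 𝔸ˣ}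

/-- ★★ **`CoerciveUnder` TRANSFERS ALONG `(Mα₀)`-SMALL DIFFERENCE MAJORANTS**: if the Λ-normalised `Q T₀(U) Q*` is coercive (constant γ) under Theorem 3.12's
prefix and the coordinate models of `T − T₀` have [4]-(2.51) majorants `(C·Mα₀)(Lʲη)²e^{−δd}` there (faithful `bI`, radius-`(ℓ+4)` count, contractive `G`-valued bond
transporters), then the Λ-normalised `Q T(U) Q*` is coercive with constant γ∕2 above `max(M₄, M₂, M_L, (d+3)log L∕(δ(2L²−1)))` for `Mα₀ ≤ min(a₀, a₂, γ∕(2(K′+1)))`,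
`K′ = K_b·C·|F|·c` (part 1 §4 entries, §5 Schur, `QGQInverse.coercive_of_form_perturbation`).
[cite: Balaban1985BackgroundPropagators, (3.132) p.422, Thm 3.12 p.423 (prefix), (3.130) p.421; Balaban1984PropagatorsII, (2.147) p.249, (2.142) p.248, Lemma 2.1 (2.60)–(2.61) p.234] -/
theorem coerciveUnder_of_subMajorants [∀ x : MemberY d ℓ hd hL b₀ b₁ Mstar, Fintype (geo9Y x).Site]
    [∀ x : MemberY d ℓ hd hL b₀ b₁ Mstar, DecidableEq (geo9Y x).Site] (bK : Module.Basis κ ℝ 𝔸) (b : Module.Basis Ff ℝ 𝔸) {c35 : ℝ}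
    (T T₀ : ∀ x : MemberY d ℓ hd hL b₀ b₁ Mstar, BondOpY 𝔸 x.toKIdx) (parB : ∀ x : MemberY d ℓ hd hL b₀ b₁ Mstar, BondParY 𝔸 x.toKIdx)
    (hparG : ∀ (x : MemberY d ℓ hd hL b₀ b₁ Mstar) (U : CfgY 𝔸 x.toKIdx), (∀ μ y, U μ y ∈ G) →
      ∀ s s', ‖(parB x U s s' : 𝔸)‖ ≤ 1 ∧ ‖(((parB x U s s')⁻¹ : 𝔸ˣ) : 𝔸)‖ ≤ 1)
    {bI : ∀ x : MemberY d ℓ hd hL b₀ b₁ Mstar, FBondY x.toKIdx → IBondY x.toKIdx}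
    (hlev : ∀ (x : MemberY d ℓ hd hL b₀ b₁ Mstar) (f : FBondY x.toKIdx), lvl x.hN x.D x.hk (bI x f) = (blkV1 x.hN x.D f).1.1)
    (hβ1 : ∀ (x : MemberY d ℓ hd hL b₀ b₁ Mstar) (f : FBondY x.toKIdx), (B6Geom246MultiLevelTorus.geomT x.D).dist (β x.hN x.D x.hk (bI x f)) (blkV1 x.hN x.D f) ≤ 1)
    {mN : ℕ} (hnbr : ∀ (x : MemberY d ℓ hd hL b₀ b₁ Mstar) (y : (geo9Y x).Site), (nbr (geo9Y x) ((ℓ : ℝ) + 4) y).card ≤ mN)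
    {R : MemberY d ℓ hd hL b₀ b₁ Mstar → ℝ} {H : MemberY d ℓ hd hL b₀ b₁ Mstar → Prop}
    (hco : CoerciveUnder c35 (fun x : MemberY d ℓ hd hL b₀ b₁ Mstar => geoComap (geo9Y x) (Prod.fst : (geo9Y x).Site × Ff → (geo9Y x).Site))
      (bg9Y 𝔸 G) (fun x U => normMatY b (lamInvY x.toKIdx) (QGQOfY x.toKIdx (parB x) (T₀ x) U)))
    (hsub : ∃ M₂ a₂ C δ : ℝ, 0 < M₂ ∧ 0 < a₂ ∧ 0 ≤ C ∧ 0 < δ ∧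
      ∀ x : MemberY d ℓ hd hL b₀ b₁ Mstar, M₂ ≤ (geo9Y x).M → ∀ α₀ : ℝ, 0 < α₀ → (geo9Y x).M * α₀ ≤ a₂ →
        ∀ U : (bg9Y 𝔸 G x).Cfg, (bg9Y 𝔸 G x).Reg335 c35 α₀ U → (bg9Y 𝔸 G x).Reg336 c35 α₀ U →
          HasMajorant (g := toB6 (geo9Y x) (R x) (H x)) (blkBK x.toKIdx (bI x)) (GcoK x.toKIdx bK (bg9Y 𝔸 G x) (fun U => U) (T x - T₀ x) U)
            (fun a a' => C * ((geo9Y x).M * α₀) * (geo9Y x).len a ^ 2 * Real.exp (-(δ * (geo9Y x).dist a a')))) :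
    CoerciveUnder c35 (fun x : MemberY d ℓ hd hL b₀ b₁ Mstar => geoComap (geo9Y x) (Prod.fst : (geo9Y x).Site × Ff → (geo9Y x).Site))
      (bg9Y 𝔸 G) (fun x U => normMatY b (lamInvY x.toKIdx) (QGQOfY x.toKIdx (parB x) (T x) U)) := by
  obtain ⟨M₄, a₀, γ, hM₄, ha₀, hγ, hco⟩ := hco
  obtain ⟨M₂, a₂, C, δ, hM₂, ha₂, hC, hδ, hmaj⟩ := hsub
  -- (2.61) at rate δ/2 for the record geometry
  obtain ⟨ML, c, hrow0⟩ := rowSum261_geo9Y (d := d) (ℓ := ℓ) (hd := hd) (hL := hL) (b₀ := b₀) (b₁ := b₁) (Mstar := Mstar) (δ / 2) (half_pos hδ)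
  set c' : ℝ := max c 0 with hc'
  have hc'0 : 0 ≤ c' := le_max_right _ _
  -- the (2.60) threshold and the perturbation constant
  set L : ℝ := ((ℓ + 1 : ℕ) : ℝ) with hLdef
  set MT : ℝ := ((d : ℝ) + 3) * Real.log L / (δ * (2 * ((ℓ : ℝ) + 1) ^ 2 - 1)) with hMT
  have hden : 0 < δ * (2 * ((ℓ : ℝ) + 1) ^ 2 - 1) := mul_pos hδ (by nlinarith [(Nat.cast_nonneg ℓ : (0 : ℝ) ≤ ℓ)])
  -- the entry prefactor of part 1 §4 (linear in the majorant constant) and the Schur constant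
  set Kb : ℝ := basisBound39 b * (‖(b.equivFunL : 𝔸 →L[ℝ] (Ff → ℝ))‖ / dimConstY' b) * (mN * Real.exp (2 * (δ * ((ℓ : ℝ) + 4)))) *
    (((ℓ + 1 : ℕ) : ℝ)) ^ (((d : ℝ) + 3) / 2) with hKb
  have hKb0 : 0 ≤ Kb := by
    rw [hKb]
    have : 0 ≤ basisBound39 b := Finset.sum_nonneg fun _ _ => norm_nonneg _
    have := dimConstY'_pos b
    positivity
  set K' : ℝ := Kb * C * (Fintype.card Ff) * c' with hK'
  have hK'0 : 0 ≤ K' := by rw [hK']; exact mul_nonneg (mul_nonneg (mul_nonneg hKb0 hC) (Nat.cast_nonneg _)) hc'0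
  set a₃ : ℝ := min (min a₀ a₂) (γ / (2 * (K' + 1))) with ha₃
  have ha₃0 : 0 < a₃ := lt_min (lt_min ha₀ ha₂) (div_pos hγ (by positivity))
  refine ⟨max (max M₄ M₂) (max ML MT), a₃, γ / 2, lt_of_lt_of_le hM₄ ((le_max_left _ _).trans (le_max_left _ _)), ha₃0, half_pos hγ,
    fun x hM α₀ hα₀ hMa U hU hU' => ?_⟩
  have hM4 : M₄ ≤ (geo9Y x).M := ((le_max_left _ _).trans (le_max_left _ _)).trans hM
  have hM2 : M₂ ≤ (geo9Y x).M := ((le_max_right _ _).trans (le_max_left _ _)).trans hM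
  have hMLx : ML ≤ (geo9Y x).M := ((le_max_left _ _).trans (le_max_right _ _)).trans hM
  have hMTx : MT ≤ (geo9Y x).M := ((le_max_right _ _).trans (le_max_right _ _)).trans hM
  have hMa0 : (geo9Y x).M * α₀ ≤ a₀ := hMa.trans ((min_le_left _ _).trans (min_le_left _ _))
  have hMa2 : (geo9Y x).M * α₀ ≤ a₂ := hMa.trans ((min_le_left _ _).trans (min_le_right _ _))
  have hMaγ : (geo9Y x).M * α₀ ≤ γ / (2 * (K' + 1)) := hMa.trans (min_le_right _ _)
  have hMα0 : 0 ≤ (geo9Y x).M * α₀ := mul_nonneg (hM₄.le.trans hM4) hα₀.le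
  have hS := hco x hM4 α₀ hα₀ hMa0 U hU hU'
  have h0 := hmaj x hM2 α₀ hα₀ hMa2 U hU hU'
  have hUG : ∀ μ y, U μ y ∈ G := hU.1.1
  have hpar := hparG x U hUG
  -- the (2.60) threshold in the member's spelling
  have hlog : ((d : ℝ) + 3) * Real.log (B9GeoNormsKLevelV1.geo9K x.toKIdx).L ≤ δ * (2 * ((ℓ : ℝ) + 1) ^ 2 - 1) * (geo9Y x).M := by
    have h1 : ((d : ℝ) + 3) * Real.log L = MT * (δ * (2 * ((ℓ : ℝ) + 1) ^ 2 - 1)) := by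
      rw [hMT, div_mul_cancel₀ _ hden.ne']
    have hLx : (B9GeoNormsKLevelV1.geo9K x.toKIdx).L = L := rfl
    rw [hLx, h1, mul_comm]
    exact mul_le_mul_of_nonneg_left hMTx hden.le
  -- §4: the entries of the normalised difference
  have hCM : 0 ≤ C * ((geo9Y x).M * α₀) := mul_nonneg hC hMα0
  have hE : ∀ a e : (geo9Y x).Site × Ff,
      |(normMatY (X := (geo9Y x).Site) b (lamInvY x.toKIdx) (QGQOfY x.toKIdx (parB x) (T x) U) -
          normMatY (X := (geo9Y x).Site) b (lamInvY x.toKIdx) (QGQOfY x.toKIdx (parB x) (T₀ x) U)) a e| ≤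
        Kb * (C * ((geo9Y x).M * α₀)) * Real.exp (-(δ / 2 * (geo9Y x).dist a.1 e.1)) := by
    -- the difference of the normalised matrices IS the normalised matrix of the difference letter (linearity, part 1 §3)
    have e0 : normMatY (X := (geo9Y x).Site) b (lamInvY x.toKIdx) (QGQOfY x.toKIdx (parB x) (T x) U) -
          normMatY (X := (geo9Y x).Site) b (lamInvY x.toKIdx) (QGQOfY x.toKIdx (parB x) (T₀ x) U) =
        normMatY (X := (geo9Y x).Site) b (lamInvY x.toKIdx) (QGQOfY x.toKIdx (parB x) (T x - T₀ x) U) := by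
      rw [← normMatY_sub]
      exact congrArg _ (QGQOfY_sub x.toKIdx (parB x) (T x) (T₀ x) U).symm
    intro a e
    have hK := abs_normMatY_QGQOfY_le_of_hasMajorant (κ := κ) x.toKIdx (instF := (inferInstance : Fintype (geo9Y x).Site))
      (instD := (inferInstance : DecidableEq (geo9Y x).Site)) bK b
      (B := bg9Y 𝔸 G x) (fun U => U) (T x - T₀ x) (parB x) U (hlev x) (hβ1 x) (hnbr x) hpar hCM hδ hlog h0 a e
    rw [e0, hKb]
    exact hK
  -- §5: the form bound `K′(Mα₀)‖v‖² ≤ (γ/2)‖v‖²`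
  have hrow : ∀ y : (geo9Y x).Site, ∑ y', Real.exp (-(δ / 2 * (geo9Y x).dist y y')) ≤ c' := fun y => (hrow0 x hMLx y).trans (le_max_left _ _)
  have hform : ∀ v : (geo9Y x).Site × Ff → ℝ,
      |v ⬝ᵥ ((normMatY (X := (geo9Y x).Site) b (lamInvY x.toKIdx) (QGQOfY x.toKIdx (parB x) (T x) U) -
          normMatY (X := (geo9Y x).Site) b (lamInvY x.toKIdx) (QGQOfY x.toKIdx (parB x) (T₀ x) U)) *ᵥ v)| ≤ γ / 2 * (v ⬝ᵥ v) := by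
    intro v
    have h := form_abs_le_of_entry_decay (X := (geo9Y x).Site) (F := Ff)
      (normMatY (X := (geo9Y x).Site) b (lamInvY x.toKIdx) (QGQOfY x.toKIdx (parB x) (T x) U) -
        normMatY (X := (geo9Y x).Site) b (lamInvY x.toKIdx) (QGQOfY x.toKIdx (parB x) (T₀ x) U))
      (geo9Y x).dist (K := Kb * (C * ((geo9Y x).M * α₀))) (σ := δ / 2) (c := c')
      (mul_nonneg hKb0 (mul_nonneg hC hMα0)) (geo9Y_dist_comm x) hrow hE v
    refine h.trans (mul_le_mul_of_nonneg_right ?_ (Literature.LinearAlgebra.Matrix.dotProduct_self_nonneg_real v))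
    have h2 : Kb * (C * ((geo9Y x).M * α₀)) * (Fintype.card Ff) * c' = K' * ((geo9Y x).M * α₀) := by rw [hK']; ring
    rw [h2]
    have h3 : K' * ((geo9Y x).M * α₀) ≤ K' * (γ / (2 * (K' + 1))) := mul_le_mul_of_nonneg_left hMaγ hK'0
    have h4 : K' * (γ / (2 * (K' + 1))) ≤ γ / 2 := by
      rw [mul_div_assoc', div_le_div_iff₀ (by positivity) (by norm_num)]
      nlinarith
    exact h3.trans h4
  have hres := coercive_of_form_perturbation hS hform
  have hγ2 : γ - γ / 2 = γ / 2 := by ring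
  rw [hγ2] at hres
  exact hres

end Transfer

/-! ## §7 ★★★ AT THE v4 RECORD (`𝔸 = M_N(ℂ)`, `G = SU(N)`): ROW 26's TWO COERCIVITY BINDERS FROM ONE FOR THE SECT. A–C PROPAGATOR -/

section Record

open Node00
open B6GlobalChartV1 (blkV1)
open B9Thm34Ext (toB6)
open B9Thm312Whole (Ops Thm33G0 Step FormSmall Identities GeoOK)
open B9PinMembersKLevelV1 (MemberY geo9Y bg9Y)
open B7Prop2SpecialUnitary (specialUnitaryUnits specialUnitaryUnits_le_unitaryUnits)
open B9Ineq349SiteFromConv342 (contractive_of_mem)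
open B9RWSumsReadsNbr (nbr)
open B9Eq3132RingInverseReading (normMatY)
open B9Eq3132NuReading (lamInvY)
open B9Eq3132CTInputs (CoerciveUnder)
open B9Eq3132ScalarIndex (geoComap)
open B9Eq3132SectDLetters (QGQY GDY)
open scoped Matrix.Norms.L2Operator

variable {κ : Type} [Fintype κ] [DecidableEq κ] {Ff : Type} [Fintype Ff] [DecidableEq Ff] {N : ℕ}

/-- ★★★ **ROW 26's COERCIVITY BINDERS FOR `(QG_DQ*)(U)` AND `(QG₁Q*)(U)` FROM ONE FOR `(QG₀Q*)(U)` AND ROW 20's DISPLAYED INPUTS** — the certificate of record's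
`hmodel12` conjuncts (Theorem 3.3 for `G₀`, the (3.131)∕(3.137) steps, the Sect.-D identities) at its coordinate pins `hblk12 ∕ hGco12 ∕ hG1co12` plus ONE more pin
`hG0co` (row 20's `G₀` IS the genuine Sect. A–C letter `(lettersYOfRecordV4 …).GA` of rows 18–19 — their pin `hGcoA` verbatim), the static geometry `GeoOK`, the
faithful block map (`hlev`, `hβ1`), a radius-`(ℓ+4)` neighbour count, and `hcoA` = Λ²-coercivity of the normalised `Q G₀(U) Q*` ([4] (2.147) transported to `U`):
`hco26` AND `hco₁26` of `…N06AtOpsYNuOfRecordV6EPairML2` (:254, :256) become theorems.  Honest: `hcoA` and row 20's inputs stay displayed hypotheses; count-neutral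
bookkeeping; NOT a node discharge. [cite: Balaban1985BackgroundPropagators, (3.132) p.422, Thm 3.12 pp.421–423, (3.130)–(3.131), (3.137)–(3.138); Balaban1984PropagatorsII, (2.147) p.249, (2.142) p.248, (2.51) p.232, Lemma 2.1 (2.60)–(2.61) p.234] -/
theorem hco26_of_hcoA_step12 (θ : Stage3Params) (Mstar : ℕ) (𝔯 : ResY N θ Mstar)
    [∀ x : MemberY θ.d₆ θ.ℓ₆ θ.hd' θ.hL' θ.b₀ θ.b₁ Mstar, Fintype (geo9Y x).Site]
    [∀ x : MemberY θ.d₆ θ.ℓ₆ θ.hd' θ.hL' θ.b₀ θ.b₁ Mstar, DecidableEq (geo9Y x).Site]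
    {Y Z W : MemberY θ.d₆ θ.ℓ₆ θ.hd' θ.hL' θ.b₀ θ.b₁ Mstar → Type} [∀ x, Fintype (Z x)] [∀ x, Fintype (W x)]
    (bK : Module.Basis κ ℝ (Matrix (Fin N) (Fin N) ℂ)) (b : Module.Basis Ff ℝ (Matrix (Fin N) (Fin N) ℂ)) {c35 : ℝ}
    (𝔬 : ∀ x : MemberY θ.d₆ θ.ℓ₆ θ.hd' θ.hL' θ.b₀ θ.b₁ Mstar,
      Ops (geo9Y x) (bg9Y (Matrix (Fin N) (Fin N) ℂ) (specialUnitaryUnits (Fin N)) x) (XBK κ x.toKIdx) (Y x) (Z x) (W x))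
    (H₀ : MemberY θ.d₆ θ.ℓ₆ θ.hd' θ.hL' θ.b₀ θ.b₁ Mstar → Prop)
    {bI : ∀ x : MemberY θ.d₆ θ.ℓ₆ θ.hd' θ.hL' θ.b₀ θ.b₁ Mstar, FBondY x.toKIdx → IBondY x.toKIdx}
    (hblk : ∀ x, (𝔬 x).blk = blkBK x.toKIdx (bI x))
    (hGco : ∀ (x : MemberY θ.d₆ θ.ℓ₆ θ.hd' θ.hL' θ.b₀ θ.b₁ Mstar) (U : (bg9Y (Matrix (Fin N) (Fin N) ℂ) (specialUnitaryUnits (Fin N)) x).Cfg),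
      (𝔬 x).G U = GcoK x.toKIdx bK (bg9Y (Matrix (Fin N) (Fin N) ℂ) (specialUnitaryUnits (Fin N)) x) (fun U => U) (lettersYOfRecordV4 N θ Mstar 𝔯 x).GD U)
    (hG1co : ∀ (x : MemberY θ.d₆ θ.ℓ₆ θ.hd' θ.hL' θ.b₀ θ.b₁ Mstar) (U : (bg9Y (Matrix (Fin N) (Fin N) ℂ) (specialUnitaryUnits (Fin N)) x).Cfg),
      (𝔬 x).G1 U = GcoK x.toKIdx bK (bg9Y (Matrix (Fin N) (Fin N) ℂ) (specialUnitaryUnits (Fin N)) x) (fun U => U) (lettersYOfRecordV4 N θ Mstar 𝔯 x).G₁ U)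
    (hG0co : ∀ (x : MemberY θ.d₆ θ.ℓ₆ θ.hd' θ.hL' θ.b₀ θ.b₁ Mstar) (U : (bg9Y (Matrix (Fin N) (Fin N) ℂ) (specialUnitaryUnits (Fin N)) x).Cfg),
      (𝔬 x).G0 U = GcoK x.toKIdx bK (bg9Y (Matrix (Fin N) (Fin N) ℂ) (specialUnitaryUnits (Fin N)) x) (fun U => U) (lettersYOfRecordV4 N θ Mstar 𝔯 x).GA U)
    (hlev : ∀ (x : MemberY θ.d₆ θ.ℓ₆ θ.hd' θ.hL' θ.b₀ θ.b₁ Mstar) (f : FBondY x.toKIdx), lvl x.hN x.D x.hk (bI x f) = (blkV1 x.hN x.D f).1.1)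
    (hβ1 : ∀ (x : MemberY θ.d₆ θ.ℓ₆ θ.hd' θ.hL' θ.b₀ θ.b₁ Mstar) (f : FBondY x.toKIdx),
      (B6Geom246MultiLevelTorus.geomT x.D).dist (β x.hN x.D x.hk (bI x f)) (blkV1 x.hN x.D f) ≤ 1)
    {mN : ℕ} (hnbr : ∀ (x : MemberY θ.d₆ θ.ℓ₆ θ.hd' θ.hL' θ.b₀ θ.b₁ Mstar) (y : (geo9Y x).Site), (nbr (geo9Y x) ((θ.ℓ₆ : ℝ) + 4) y).card ≤ mN)
    (θ₁ r₁ B₀ δ₀ δK σ ρ a₁ M₁ : ℝ) (hθ₁ : 0 ≤ θ₁) (hB₀ : 0 ≤ B₀) (hσ : 0 < σ) (hρ : 0 < ρ) (hρS : ρ ≤ δ₀) (hρδ : ρ + σ ≤ δK)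
    (ha₁ : 0 < a₁) (hM₁ : 0 < M₁) (hgeo : ∀ x : MemberY θ.d₆ θ.ℓ₆ θ.hd' θ.hL' θ.b₀ θ.b₁ Mstar, GeoOK (geo9Y x))
    (hmodel : ∀ x : MemberY θ.d₆ θ.ℓ₆ θ.hd' θ.hL' θ.b₀ θ.b₁ Mstar, M₁ ≤ (geo9Y x).M → ∀ α₀ : ℝ, 0 < α₀ → (geo9Y x).M * α₀ ≤ a₁ →
      ∀ U : (bg9Y (Matrix (Fin N) (Fin N) ℂ) (specialUnitaryUnits (Fin N)) x).Cfg,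
        (bg9Y (Matrix (Fin N) (Fin N) ℂ) (specialUnitaryUnits (Fin N)) x).Reg335 c35 α₀ U →
        (bg9Y (Matrix (Fin N) (Fin N) ℂ) (specialUnitaryUnits (Fin N)) x).Reg336 c35 α₀ U →
          Thm33G0 (𝔬 x) 1 (H₀ x) B₀ δ₀ U ∧
          Step (𝔬 x) 1 (H₀ x) (hgeo x).lenle 1 (θ₁ * ((geo9Y x).M * α₀)) δK U ∧
          Step (𝔬 x) 1 (H₀ x) (hgeo x).lenle 2 (θ₁ * ((geo9Y x).M * α₀)) δK U ∧
          FormSmall (𝔬 x) (r₁ * ((geo9Y x).M * α₀)) U ∧ Identities (𝔬 x) U)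
    (hcoA : CoerciveUnder c35
        (fun x : MemberY θ.d₆ θ.ℓ₆ θ.hd' θ.hL' θ.b₀ θ.b₁ Mstar => geoComap (geo9Y x) (Prod.fst : (geo9Y x).Site × Ff → (geo9Y x).Site))
        (bg9Y (Matrix (Fin N) (Fin N) ℂ) (specialUnitaryUnits (Fin N)))
        (fun x U => normMatY b (lamInvY x.toKIdx) (QGQOfY x.toKIdx (parBY x.toKIdx) (lettersYOfRecordV4 N θ Mstar 𝔯 x).GA U))) :
    CoerciveUnder c35
        (fun x : MemberY θ.d₆ θ.ℓ₆ θ.hd' θ.hL' θ.b₀ θ.b₁ Mstar => geoComap (geo9Y x) (Prod.fst : (geo9Y x).Site × Ff → (geo9Y x).Site))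
        (bg9Y (Matrix (Fin N) (Fin N) ℂ) (specialUnitaryUnits (Fin N)))
        (fun x U => normMatY b (lamInvY x.toKIdx) (QGQY x.toKIdx (parSymY x.toKIdx) (parBY x.toKIdx) (GpY x.toKIdx (parSymY x.toKIdx)) U)) ∧
      CoerciveUnder c35
        (fun x : MemberY θ.d₆ θ.ℓ₆ θ.hd' θ.hL' θ.b₀ θ.b₁ Mstar => geoComap (geo9Y x) (Prod.fst : (geo9Y x).Site × Ff → (geo9Y x).Site))
        (bg9Y (Matrix (Fin N) (Fin N) ℂ) (specialUnitaryUnits (Fin N)))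
        (fun x U => normMatY b (lamInvY x.toKIdx)
          (QGQOfY x.toKIdx (parBY x.toKIdx) (G1Y x.toKIdx (parSymY x.toKIdx) (parBY x.toKIdx) (GpY x.toKIdx (parSymY x.toKIdx)) (𝔯 x).Δ2) U)) := by
  have hparG : ∀ (x : MemberY θ.d₆ θ.ℓ₆ θ.hd' θ.hL' θ.b₀ θ.b₁ Mstar) (U : CfgY (Matrix (Fin N) (Fin N) ℂ) x.toKIdx),
      (∀ μ y, U μ y ∈ specialUnitaryUnits (Fin N)) → ∀ s s', ‖(parBY x.toKIdx U s s' : Matrix (Fin N) (Fin N) ℂ)‖ ≤ 1 ∧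
        ‖(((parBY x.toKIdx U s s')⁻¹ : (Matrix (Fin N) (Fin N) ℂ)ˣ) : Matrix (Fin N) (Fin N) ℂ)‖ ≤ 1 :=
    fun x U hUG s s' => contractive_of_mem specialUnitaryUnits_le_unitaryUnits (parBY_mem x.toKIdx hUG s s')
  obtain ⟨M₂, a₂, C, δ, hM₂, ha₂, hC, hδ, hmaj⟩ := subMajorants_of_step12 (G := specialUnitaryUnits (Fin N)) bK 𝔬 H₀
    (fun x => (lettersYOfRecordV4 N θ Mstar 𝔯 x).GD) (fun x => (lettersYOfRecordV4 N θ Mstar 𝔯 x).G₁) (fun x => (lettersYOfRecordV4 N θ Mstar 𝔯 x).GA)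
    hblk hGco hG1co hG0co θ₁ r₁ B₀ δ₀ δK σ ρ a₁ M₁ hθ₁ hB₀ hσ hρ hρS hρδ ha₁ hM₁ hgeo hmodel
  exact ⟨coerciveUnder_of_subMajorants (G := specialUnitaryUnits (Fin N)) bK b (fun x => (lettersYOfRecordV4 N θ Mstar 𝔯 x).GD)
      (fun x => (lettersYOfRecordV4 N θ Mstar 𝔯 x).GA) (fun x => parBY x.toKIdx) hparG hlev hβ1 hnbr (R := fun _ => 1) hcoA
      ⟨M₂, a₂, C, δ, hM₂, ha₂, hC, hδ, fun x hM α₀ hα₀ hMa U hU hU' => (hmaj x hM α₀ hα₀ hMa U hU hU').1⟩,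
    coerciveUnder_of_subMajorants (G := specialUnitaryUnits (Fin N)) bK b (fun x => (lettersYOfRecordV4 N θ Mstar 𝔯 x).G₁)
      (fun x => (lettersYOfRecordV4 N θ Mstar 𝔯 x).GA) (fun x => parBY x.toKIdx) hparG hlev hβ1 hnbr (R := fun _ => 1) hcoA
      ⟨M₂, a₂, C, δ, hM₂, ha₂, hC, hδ, fun x hM α₀ hα₀ hMa U hU hU' => (hmaj x hM α₀ hα₀ hMa U hU hU').2⟩⟩

end Record

end Literature.MathematicalPhysics.QuantumFieldTheory.Balaban1983to89.B9Eq3132CoerciveFromGA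

end
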